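import Summits.ResolutionOfSingularities.KangarooAtlas.MizutaniLemma29
import Mathlib.LinearAlgebra.Dimension.OrzechProperty
import Mathlib.RingTheory.Derivation.Basic
import HarnessLib

/-!
# Mizutani's Lemma 2.9 (2) — the converse direction: `ker(u · D₀ ∘ D₀)` has dimension `2p`

Cell topic `Summits/ResolutionOfSingularities/KangarooAtlas` (pub-rosobs); namespace
`Summit.ResolutionOfSingularities.KangarooAtlas.Mizutani`.  Part of the Lean transcription of Mizutani 1973 §2
around the in-house note MIZUTANI-PROOF-g59 (AI-written, AI-audited; *AI review is weaker than expert review*; not a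
resolution theorem).

Mizutani, Nagoya Math. J. 52 (1973), Lemma 2.9 (2), p. 93: «the equality [`dim_{k^p} ker(D) = 2p`] holds if and only if
there exists `D₀ ∈ Der(K/k^p)` with the property `D₀(c₁) = 0` and `D₀(c₂) = 1` where `k^p(c₁, c₂) = K`, such that
`D = u·D₀²` with `u ∈ K`.»  This file proves the «if» direction on a root tower `h : IsRootTower L K p x a`
(`a = (c₁, c₂)`, `[K : L] = p²`, `p ≠ 2`):

* `IsRootTower.hsDer` — the Hasse–Schmidt operator `D^{(e_l)}` as a Mathlib `Derivation` (`∂/∂a_l`), `hsDer_gen`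
  (`∂_l a_j = δ_{lj}`); `IsRootTower.adjoin_range_eq_top`; `IsRootTower.derivation_eq_of_apply_gen` (a derivation of
  `K/L` is determined by its values on the `p`-basis);
* `IsRootTower.boxBasis` — the `L`-basis `a^W`, `W ∈ [0,q)^s`, of `K`;
* `IsRootTower.hsD_single_one_comp_self` — `∂₂ ∘ ∂₂ = 2 · D^{(0,2)}`;
* **`IsRootTower.finrank_ker_hsD_single_two`** — `dim_L ker D^{(0,2)} = 2p`, and
  `IsRootTower.ker_hsD_single_two_eq_span` — `ker D^{(0,2)} = L(a₁) ⊕ L(a₁)·a₂` (the span of the monomials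
  `a₁^m a₂^j`, `j ≤ 1`);
* **`IsRootTower.finrank_ker_eq_two_mul_of_eq_smul_comp`** — LEMMA 2.9 (2), «if»: `D = u·(D₀ ∘ D₀)` with `u ≠ 0`,
  `D₀ a₁ = 0`, `D₀ a₂ = 1` ⇒ `dim_L ker D = 2p`.

References: [Mizutani1973HironakaGroupSchemes] Lemma 2.9 (2), p. 93–94.
-/

open MvPolynomial Literature.AlgebraicGeometry.Resolution

namespace Summit.ResolutionOfSingularities.KangarooAtlas.Mizutani

universe u

section General

variable {L K : Type*} [Field L] [Field K] [Algebra L K] {s p e : ℕ} [hp : Fact p.Prime] [CharP K p]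
  {x : Fin s → L} {a : Fin s → K}

/-! ### The derivations `∂_l = D^{(e_l)}` -/

/-- **Leibniz rule in order one**: `D^{(e_l)}(yz) = D^{(e_l)}(y) z + y D^{(e_l)}(z)`. [cite: EGAIV4, Thm. 16.11.2 (16.11.2.2)] -/
theorem IsRootTower.hsD_single_mul (h : IsRootTower L K (p ^ e) x a) (he : 1 ≤ e) (l : Fin s) (y z : K) :
    h.hsD (Finsupp.single l 1) (y * z) =
      h.hsD (Finsupp.single l 1) y * z + y * h.hsD (Finsupp.single l 1) z := by
  rw [h.hsD_mul (inBox_single_one he l), Finsupp.antidiagonal_single, Finset.sum_map, Finset.Nat.sum_antidiagonal_succ,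
    Finset.Nat.antidiagonal_zero, Finset.sum_singleton]
  simp only [Function.Embedding.coe_prodMap, Function.Embedding.coeFn_mk, Prod.map_apply, Finsupp.single_zero, zero_add]
  rw [h.hsD_zero, LinearMap.id_apply, LinearMap.id_apply]
  ring

/-- **The derivation `∂_l = D^{(e_l)}`** of `K` over `L` (`∂_l a_j = δ_{lj}`), as a Mathlib `Derivation`.
[cite: EGAIV4, Thm. 16.11.2 (D_{e_l} is a derivation)] -/
noncomputable def IsRootTower.hsDer (h : IsRootTower L K (p ^ e) x a) (he : 1 ≤ e) (l : Fin s) : Derivation L K K where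
  toLinearMap := h.hsD (Finsupp.single l 1)
  map_one_eq_zero' := h.hsD_single_one he l
  leibniz' y z := by
    change h.hsD (Finsupp.single l 1) (y * z) = y • h.hsD (Finsupp.single l 1) z + z • h.hsD (Finsupp.single l 1) y
    rw [h.hsD_single_mul he, smul_eq_mul, smul_eq_mul]
    ring

/-- `∂_l y = D^{(e_l)} y`. [folklore] -/
theorem IsRootTower.hsDer_apply (h : IsRootTower L K (p ^ e) x a) (he : 1 ≤ e) (l : Fin s) (y : K) :
    h.hsDer he l y = h.hsD (Finsupp.single l 1) y := rfl

/-- `∂_l` as a linear map is `D^{(e_l)}`. [folklore] -/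
theorem IsRootTower.hsDer_coe (h : IsRootTower L K (p ^ e) x a) (he : 1 ≤ e) (l : Fin s) :
    ((h.hsDer he l : Derivation L K K) : K →ₗ[L] K) = h.hsD (Finsupp.single l 1) := rfl

/-- `∂_l a_j = δ_{lj}`. [cite: EGAIV4, Thm. 16.11.2 (16.11.2.1)] -/
theorem IsRootTower.hsDer_gen (h : IsRootTower L K (p ^ e) x a) (he : 1 ≤ e) (l j : Fin s) :
    h.hsDer he l (a j) = if j = l then 1 else 0 := by
  rw [h.hsDer_apply]
  by_cases hjl : j = l
  · subst hjl; rw [if_pos rfl, h.hsD_single_gen he]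
  · rw [if_neg hjl]
    have key := h.hsD_prod_pow (inBox_single_one he l) (Finsupp.single j 1)
    rw [prod_pow_single_eq, mchoose_eq_zero_of_not_le, Nat.cast_zero, zero_mul] at key
    · exact key
    · intro hle
      have := hle l
      rw [Finsupp.single_eq_same, Finsupp.single_apply, if_neg hjl] at this
      omega

omit hp [CharP K p] in
/-- **The generators `a_i` generate `K` as an `L`-algebra.** [cite: Mizutani1973HironakaGroupSchemes, Remark 2.10 (in-house proof §1.1)] -/
theorem IsRootTower.adjoin_range_eq_top (h : IsRootTower L K (p ^ e) x a) : Algebra.adjoin L (Set.range a) = ⊤ := by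
  refine eq_top_iff.mpr fun z _ => ?_
  obtain ⟨ξ, rfl⟩ := h.bijective.2 z
  obtain ⟨F, rfl⟩ := Ideal.Quotient.mk_surjective ξ
  rw [liftHom_mk, Algebra.adjoin_range_eq_range_aeval]
  exact ⟨F, rfl⟩

omit hp [CharP K p] in
/-- **A derivation of `K/L` is determined by its values on the generators.** [folklore] -/
theorem IsRootTower.derivation_eq_of_apply_gen (h : IsRootTower L K (p ^ e) x a) {D₁ D₂ : Derivation L K K}
    (hD : ∀ j, D₁ (a j) = D₂ (a j)) : D₁ = D₂ := by
  have hEq : Set.EqOn D₁ D₂ (Set.range a) := by rintro _ ⟨j, rfl⟩; exact hD j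
  have key := Derivation.eqOn_adjoin hEq
  rw [h.adjoin_range_eq_top] at key
  exact Derivation.ext fun y => key Algebra.mem_top

/-- A derivation with `D₀ a_j = δ_{jl}` IS `∂_l`. [folklore] -/
theorem IsRootTower.derivation_eq_hsDer (h : IsRootTower L K (p ^ e) x a) (he : 1 ≤ e) (l : Fin s)
    {D₀ : Derivation L K K} (hD₀ : ∀ j, D₀ (a j) = if j = l then 1 else 0) : D₀ = h.hsDer he l :=
  h.derivation_eq_of_apply_gen fun j => by rw [hD₀, h.hsDer_gen]

/-! ### The box-monomial basis -/

/-- **The `L`-basis `a^W`, `W ∈ [0,q)^s`, of the tower** (it spans, and `[K : L] = q^s`).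
[cite: Mizutani1973HironakaGroupSchemes, Remark 2.10 (in-house proof §1.1: the monomials a^W form an L-basis)] -/
noncomputable def IsRootTower.boxBasis (h : IsRootTower L K (p ^ e) x a) : Module.Basis (Fin s → Fin (p ^ e)) L K :=
  basisOfTopLeSpanOfCardEqFinrank (fun W => ∏ i, a i ^ (W i : ℕ))
    (by
      rintro z -
      have hz := h.mem_span z
      refine Submodule.span_mono ?_ hz
      rintro _ ⟨N, hN, rfl⟩
      exact ⟨fun i => ⟨N i, hN i⟩, rfl⟩)
    (by haveI := h.finiteDimensional; rw [h.finrank_eq, Fintype.card_fun, Fintype.card_fin, Fintype.card_fin])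

/-- The basis vectors are the box monomials. [folklore] -/
theorem IsRootTower.boxBasis_apply (h : IsRootTower L K (p ^ e) x a) (W : Fin s → Fin (p ^ e)) :
    h.boxBasis W = ∏ i, a i ^ (W i : ℕ) := by
  unfold IsRootTower.boxBasis
  rw [coe_basisOfTopLeSpanOfCardEqFinrank]

end General

/-! ### The kernel of `D^{(0,2)}` on a two-generator tower of exponent `p` -/

section KernelCount

variable {L K : Type u} [Field L] [Field K] [Algebra L K] {p : ℕ} [hp : Fact p.Prime] [CharP K p]
  {x : Fin 2 → L} {a : Fin 2 → K}

/-- `(2 : K) ≠ 0` in characteristic `p ≠ 2`. [folklore] -/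
theorem two_ne_zero_of_ne_two (hp2 : p ≠ 2) : (2 : K) ≠ 0 := by
  intro h2
  have h2' : ((2 : ℕ) : K) = 0 := by exact_mod_cast h2
  rw [CharP.cast_eq_zero_iff K p] at h2'
  exact hp2 ((Nat.prime_dvd_prime_iff_eq hp.out Nat.prime_two).mp h2')

/-- `∂₁ ∘ ∂₁ = 2 · D^{(0,2)}` (composition rule, `C(2,1) = 2`). [cite: EGAIV4, Thm. 16.11.2 (16.11.2.2)] -/
theorem IsRootTower.hsD_single_one_comp_self (h : IsRootTower L K (p ^ 1) x a) (i : Fin 2) :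
    h.hsD (Finsupp.single i 1) ∘ₗ h.hsD (Finsupp.single i 1) = (2 : K) • h.hsD (Finsupp.single i 2) := by
  rw [h.hsD_comp, ← Finsupp.single_add]
  congr 1
  rw [mchoose_eq_prod, Fin.prod_univ_two]
  fin_cases i <;> simp

omit hp in
/-- The `2p` monomials `a₀^m a₁^j`, `m < p`, `j ≤ 1`, as an index map into the box. [folklore] -/
def lowIdx (p : ℕ) (hp2 : 2 ≤ p) : Fin p × Fin 2 → (Fin 2 → Fin (p ^ 1)) :=
  fun mj => ![⟨mj.1, by rw [pow_one]; exact mj.1.2⟩, ⟨mj.2, by rw [pow_one]; exact lt_of_lt_of_le mj.2.2 hp2⟩]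

omit hp in
/-- `lowIdx` is injective. [folklore] -/
theorem lowIdx_injective (hp2 : 2 ≤ p) : Function.Injective (lowIdx p hp2) := by
  intro mj mj' heq
  have h0 := congrArg (fun W : Fin 2 → Fin (p ^ 1) => ((W 0 : ℕ), (W 1 : ℕ))) heq
  simp only [lowIdx, Matrix.cons_val_zero, Matrix.cons_val_one, Prod.mk.injEq] at h0
  exact Prod.ext (Fin.ext h0.1) (Fin.ext h0.2)

/-- The monomials `a₀^m a₁^j`, `j ≤ 1`, lie in `ker D^{(0,2)}` (`C(j,2) = 0`). [cite: Mizutani1973HironakaGroupSchemes, Lemma 2.9 (2) (proof: dim ker D₀² = 2p)] -/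
theorem IsRootTower.boxBasis_lowIdx_mem_ker (h : IsRootTower L K (p ^ 1) x a) (hp2 : 2 ≤ p) (mj : Fin p × Fin 2) :
    h.boxBasis (lowIdx p hp2 mj) ∈ LinearMap.ker (h.hsD (Finsupp.single 1 2)) := by
  rw [LinearMap.mem_ker, h.boxBasis_apply]
  set N : Fin 2 →₀ ℕ := finsuppOf (lowIdx p hp2 mj) with hN
  have hprod : (∏ i, a i ^ ((lowIdx p hp2 mj i : Fin (p ^ 1)) : ℕ)) = ∏ i, a i ^ N i :=
    Finset.prod_congr rfl fun i _ => by rw [hN, finsuppOf_apply]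
  rw [hprod, h.hsD_prod_pow' _ _ (inBox_finsuppOf _), mchoose_eq_zero_of_not_le, Nat.cast_zero, zero_mul]
  intro hle
  have h1 := hle 1
  rw [Finsupp.single_eq_same, finsuppOf_apply] at h1
  have : ((lowIdx p hp2 mj 1 : Fin (p ^ 1)) : ℕ) = mj.2 := rfl
  rw [this] at h1
  have := mj.2.2
  omega

/-- `D^{(0,2)} ≠ 0` (`p ≠ 2`): its value on `a₁²` is `1`. [folklore] -/
theorem IsRootTower.hsD_single_two_ne_zero (h : IsRootTower L K (p ^ 1) x a) (hp2 : p ≠ 2) (i : Fin 2) :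
    h.hsD (Finsupp.single i 2) ≠ 0 := by
  have hp3 : 2 < p ^ 1 := by
    rw [pow_one]; have := hp.out.two_le; omega
  have hbox : InBox (p ^ 1) (Finsupp.single i 2 : Fin 2 →₀ ℕ) := by
    intro j; rw [Finsupp.single_apply]; split_ifs <;> omega
  intro h0
  have key := h.hsD_prod_pow hbox (Finsupp.single i 2)
  rw [h0, LinearMap.zero_apply, mchoose_self, Nat.cast_one, one_mul] at key
  have h1 : (∏ j, a j ^ ((Finsupp.single i 2 : Fin 2 →₀ ℕ) j - (Finsupp.single i 2 : Fin 2 →₀ ℕ) j)) = (1 : K) :=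
    Finset.prod_eq_one fun j _ => by rw [Nat.sub_self, pow_zero]
  rw [h1] at key
  exact zero_ne_one key

/-- `D^{(0,2)}` kills the generators. [folklore] -/
theorem IsRootTower.hsD_single_two_gen (h : IsRootTower L K (p ^ 1) x a) (i j : Fin 2) :
    h.hsD (Finsupp.single i 2) (a j) = 0 := by
  rw [← prod_pow_single_eq (a := a) j, h.hsD_prod_pow' _ _ (inBox_single_one le_rfl j), mchoose_eq_zero_of_not_le,
    Nat.cast_zero, zero_mul]
  intro hle
  have := hle i
  rw [Finsupp.single_eq_same, Finsupp.single_apply] at this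
  split_ifs at this <;> omega

/-- **`dim_L ker D^{(0,2)} = 2p`** on a two-generator root tower of exponent `p ≠ 2`: the `2p` monomials `a₀^m a₁^j`,
`j ≤ 1`, are independent elements of the kernel, and Lemma 2.9 (1) bounds the kernel by `2p`.
[cite: Mizutani1973HironakaGroupSchemes, Lemma 2.9 (2) (proof, p. 94: «2p = dim ker(D) = dim ker(D₀²) ≤ 2 dim ker(D₀) ≤ 2p»)] -/
theorem IsRootTower.finrank_ker_hsD_single_two (h : IsRootTower L K (p ^ 1) x a) (hp2 : p ≠ 2) :
    Module.finrank L (LinearMap.ker (h.hsD (Finsupp.single 1 2))) = 2 * p := by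
  classical
  haveI := h.finiteDimensional
  have hp2' : 2 ≤ p := hp.out.two_le
  -- upper bound: Lemma 2.9 (1)
  have hbox : InBox (p ^ 1) (Finsupp.single 1 2 : Fin 2 →₀ ℕ) := by
    intro j; rw [Finsupp.single_apply, pow_one]; split_ifs <;> omega
  have hle : Module.finrank L (LinearMap.ker (h.hsD (Finsupp.single 1 2))) ≤ 2 * p :=
    h.finrank_ker_le_two_mul _ (h.isDiffOpLE_hsD 2 hbox (by simp))
      (h.hsD_single_two_ne_zero hp2 1) (h.hsD_one _ (Finsupp.single_ne_zero.mpr (by norm_num)))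
      (h.hsD_single_two_gen 1)
  -- lower bound: the `2p` independent monomials
  have hli : LinearIndependent L (fun mj : Fin p × Fin 2 => h.boxBasis (lowIdx p hp2' mj)) :=
    h.boxBasis.linearIndependent.comp _ (lowIdx_injective hp2')
  have hspan : Submodule.span L (Set.range fun mj : Fin p × Fin 2 => h.boxBasis (lowIdx p hp2' mj)) ≤
      LinearMap.ker (h.hsD (Finsupp.single 1 2)) :=
    Submodule.span_le.mpr (by rintro _ ⟨mj, rfl⟩; exact h.boxBasis_lowIdx_mem_ker hp2' mj)
  have hge := Submodule.finrank_mono hspan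
  rw [finrank_span_eq_card hli, Fintype.card_prod, Fintype.card_fin, Fintype.card_fin, mul_comm] at hge
  exact le_antisymm hle hge

/-- **`ker D^{(0,2)} = L(a₀) ⊕ L(a₀)·a₁`**: the kernel IS the span of the monomials `a₀^m a₁^j`, `j ≤ 1`.
[cite: Mizutani1973HironakaGroupSchemes, Lemma 2.9 (2) and Theorem 2.8 (Step (I): «H is of the same type as Example 2.1»)] -/
theorem IsRootTower.ker_hsD_single_two_eq_span (h : IsRootTower L K (p ^ 1) x a) (hp2 : p ≠ 2) :
    LinearMap.ker (h.hsD (Finsupp.single 1 2)) =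
      Submodule.span L (Set.range fun mj : Fin p × Fin 2 => a 0 ^ (mj.1 : ℕ) * a 1 ^ (mj.2 : ℕ)) := by
  classical
  haveI := h.finiteDimensional
  have hp2' : 2 ≤ p := hp.out.two_le
  have hfam : (fun mj : Fin p × Fin 2 => a 0 ^ (mj.1 : ℕ) * a 1 ^ (mj.2 : ℕ)) =
      fun mj : Fin p × Fin 2 => h.boxBasis (lowIdx p hp2' mj) := by
    funext mj
    rw [h.boxBasis_apply, Fin.prod_univ_two]
    rfl
  rw [hfam]
  have hli : LinearIndependent L (fun mj : Fin p × Fin 2 => h.boxBasis (lowIdx p hp2' mj)) :=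
    h.boxBasis.linearIndependent.comp _ (lowIdx_injective hp2')
  have hspan : Submodule.span L (Set.range fun mj : Fin p × Fin 2 => h.boxBasis (lowIdx p hp2' mj)) ≤
      LinearMap.ker (h.hsD (Finsupp.single 1 2)) :=
    Submodule.span_le.mpr (by rintro _ ⟨mj, rfl⟩; exact h.boxBasis_lowIdx_mem_ker hp2' mj)
  symm
  refine Submodule.eq_of_le_of_finrank_eq hspan ?_
  rw [finrank_span_eq_card hli, Fintype.card_prod, Fintype.card_fin, Fintype.card_fin, h.finrank_ker_hsD_single_two hp2,
    mul_comm]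

/-! ### Lemma 2.9 (2), the «if» direction -/

/-- **MIZUTANI'S LEMMA 2.9 (2), «if» direction (tower form).**  On a two-generator root tower `K = L(a₀, a₁)` of
exponent `p ≠ 2`: if `D = u·(D₀ ∘ D₀)` for a unit `u ∈ K` and a derivation `D₀` of `K/L` with `D₀ a₀ = 0`, `D₀ a₁ = 1`
(so `D₀ = ∂/∂a₁` and `D = 2u·D^{(0,2)}`), then `dim_L ker D = 2p`.
[cite: Mizutani1973HironakaGroupSchemes, Lemma 2.9 (2), p. 93] -/
theorem IsRootTower.finrank_ker_eq_two_mul_of_eq_smul_comp (h : IsRootTower L K (p ^ 1) x a) (hp2 : p ≠ 2)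
    (D₀ : Derivation L K K) (hD₀0 : D₀ (a 0) = 0) (hD₀1 : D₀ (a 1) = 1) {u : K} (hu : u ≠ 0) {D : K →ₗ[L] K}
    (hD : D = u • ((D₀ : K →ₗ[L] K) ∘ₗ (D₀ : K →ₗ[L] K))) :
    Module.finrank L (LinearMap.ker D) = 2 * p := by
  have hD₀ : D₀ = h.hsDer le_rfl 1 :=
    h.derivation_eq_hsDer le_rfl 1 fun j => by fin_cases j <;> simp [hD₀0, hD₀1]
  have hDeq : D = (u * 2) • h.hsD (Finsupp.single 1 2) := by
    rw [hD, hD₀, h.hsDer_coe, h.hsD_single_one_comp_self, smul_smul]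
  have hker : LinearMap.ker D = LinearMap.ker (h.hsD (Finsupp.single 1 2)) := by
    rw [hDeq]
    ext y
    simp only [LinearMap.mem_ker, LinearMap.smul_apply, smul_eq_mul, mul_eq_zero, hu, two_ne_zero_of_ne_two hp2,
      false_or]
  rw [hker, h.finrank_ker_hsD_single_two hp2]

/-- The same with the KERNEL DESCRIBED: under the hypotheses of the «if» direction, `ker D = L(a₀) ⊕ L(a₀)·a₁` (the span
of the `a₀^m a₁^j`, `j ≤ 1`) — Mizutani's «`c(f) = k^p(c₁) ⊕ k^p(c₁)c₂`, the same type as Example 2.1».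
[cite: Mizutani1973HironakaGroupSchemes, Lemma 2.9 (2) and Theorem 2.8, Step (I), p. 92] -/
theorem IsRootTower.ker_eq_span_of_eq_smul_comp (h : IsRootTower L K (p ^ 1) x a) (hp2 : p ≠ 2)
    (D₀ : Derivation L K K) (hD₀0 : D₀ (a 0) = 0) (hD₀1 : D₀ (a 1) = 1) {u : K} (hu : u ≠ 0) {D : K →ₗ[L] K}
    (hD : D = u • ((D₀ : K →ₗ[L] K) ∘ₗ (D₀ : K →ₗ[L] K))) :
    LinearMap.ker D = Submodule.span L (Set.range fun mj : Fin p × Fin 2 => a 0 ^ (mj.1 : ℕ) * a 1 ^ (mj.2 : ℕ)) := by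
  have hD₀ : D₀ = h.hsDer le_rfl 1 :=
    h.derivation_eq_hsDer le_rfl 1 fun j => by fin_cases j <;> simp [hD₀0, hD₀1]
  have hDeq : D = (u * 2) • h.hsD (Finsupp.single 1 2) := by
    rw [hD, hD₀, h.hsDer_coe, h.hsD_single_one_comp_self, smul_smul]
  have hker : LinearMap.ker D = LinearMap.ker (h.hsD (Finsupp.single 1 2)) := by
    rw [hDeq]
    ext y
    simp only [LinearMap.mem_ker, LinearMap.smul_apply, smul_eq_mul, mul_eq_zero, hu, two_ne_zero_of_ne_two hp2,
      false_or]
  rw [hker, h.ker_hsD_single_two_eq_span hp2]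

end KernelCount

end Summit.ResolutionOfSingularities.KangarooAtlas.Mizutani
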